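import Mathlib
import HarnessLib
import Summits.HubbardSuperconductivity.HubbardSuperconductivity.Theorems.KLProgrammeKLRegimeEngineTowerWtStepLinkUniform
import Summits.HubbardSuperconductivity.HubbardSuperconductivity.Theorems.KLProgrammeKLRegimeEngineTowerPartialIncrLevOriented

/-!
# Route `KLProgramme` — crux K3 ENGINE (stmt-HubbardSuperconductivity-20437 `KLRegimeEngineV17F2`), stub (b), THE WEIGHTED CONJUNCT «(b)-WT4»:
# THE WEIGHTED BLOCK-STEP KIT ON A PARTIAL INCREMENT `𝒱_{J₂} − 𝒱_{dk}`, `dk ≤ J₂`, AT ANY OUTPUT FAMILY `F_{J′}`, `dk ≤ J′`, AND ANY RATE `j`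
# (cell gate-hubbard-kl, seat gate-hubbard-kl-p3 g22, «WT-BASE» file WB1 — the weighted twin of the levelled partial-increment kit
#  `…TowerPartialIncrLevKitFOne` / `…TowerPartialIncrLevStepFOne` (p692692 / p693059); serves k3c3-p2's RO-2ʷ and the block-0 weighted base law WB2)

The tree's weighted block-step doors `blockStep_ordersGe2_wt_le` / `blockStep_firstOrder_wt_le` (…TowerBlockStepWt) are stated for an ARBITRARY slice
`(Λ_{J₂}, Λ_{J₁}]`, `1 ≤ J₁ ≤ J₂`; `klWtPinnedSumAt_klTowerIncr_le` (…TowerBlockIncrWtRate) specialises them to the tower's block increment `Δ_k`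
(`(J₁, J₂) = (dk, d(k+1))`).  Here the SAME proofs are run on the partial increment `𝒱_{J₂} − 𝒱_{dk}` (`partialIncr_eq_ordersGe2_add_firstOrder`,
…TowerPartialIncrLevOriented), slice `(Λ_{J₂}, Λ_{dk}]`, input `𝒱_{dk}` read at `F̃_{dk−1}`:

* §1 **`klWtPinnedSumAt_partialIncr_le`** — door form; §2 **`klWtPinnedSumAt_partialIncr_le_kit`** — kit form (kit guard on `ε^{2m′}·B m′`);
* §3 **`klWtPinnedSumAt_partialIncr_le_kit_units`** — the carrier `klTowerMeasWtAt … d k j` as input majorant, dimensionless form in any units `(u, Kc)`;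
* §4 **`klWtPinnedSumAt_partialIncr_le_kitStep_of_bounds`** — the step in track-`0` FLOOR UNITS at k-free bounds (`κ²·8^{dk} ≤ κ̄²`, `α ≤ ᾱ·4^{dk}`, overlaps
  `≤ c̄r, c̄c`), W2's literal right side: `klWtPinnedSumAt … J′ j (2(q+1)) (𝒱_{J₂} − 𝒱_{dk}) i w″ / klLevUnitF β M 0 (q+1) (dk) ≤ towerFO D σ̄ μ̄ (q+1) +
  Σ_{n ∈ Icc 2 N} e·Φ̄^{n−1}·ψ̄^{q+1}·towerS D τ̄ μ̄ n (q+1) + ψ̄^{q+1}·e·towerV D τ̄ μ̄·(Φ̄·towerV D τ̄ μ̄)^N/(1 − Φ̄·towerV D τ̄ μ̄)`,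
  `μ̄ m = (32c̄r/c̄c)·(ε²c̄c²/8)^m·klTowerMeasWtAt … d k j (2m)/klLevUnitF β M 0 m (dk−1)`, `σ̄ = κ̄²/c̄c²`, `τ̄ = 4e⁴κ̄²/c̄c²`, `ψ̄ = c̄c²/κ̄²`, `Φ̄ = e·ᾱ·c̄c/(κ̄²·c̄r)`.
Compositions of landed theorems and real algebra; nothing about the model is asserted beyond them; nothing asserts (b), WT4, (ℓ), any stub, K3 or superconductivity.
References: BGM 2006 §2.8 (2.76)–(2.84), §3 (3.2)–(3.8) [cite: BenfattoGiulianiMastropietro2006]; Gawȩdzki–Kupiainen 1985 §3.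
-/

noncomputable section

namespace Summit.HubbardSuperconductivity.HubbardSuperconductivity.Theorems.EngineV8

set_option linter.dupNamespace false -- summit = problem name (single-conjunct summit), D-0017

open Classical
open Real Finset Literature.MathematicalPhysics.QuantumLattice Literature.Probability.LatticeModels GrassmannAlgebra
open Literature.MathematicalPhysics.QuantumLattice.FermiRG
open Summit.HubbardSuperconductivity.HubbardSuperconductivity.Theorems.KLProgrammeLegKernels
open Summit.HubbardSuperconductivity.HubbardSuperconductivity.Theorems.KLRegimeSplit
open Summit.HubbardSuperconductivity.HubbardSuperconductivity.Theorems.KLRegimeWick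
open Summit.HubbardSuperconductivity.HubbardSuperconductivity.Theorems.TwoPointAssembly
open Summit.HubbardSuperconductivity.HubbardSuperconductivity.Theorems.DispersionFlow
open Literature.Probability.LatticeModels.BattleFederbush

variable {L M : ℕ} [NeZero L] [NeZero M]

/-- §1 **THE WEIGHTED BLOCK-STEP DOOR ON THE PARTIAL INCREMENT `𝒱_{J₂} − 𝒱_{dk}`** (`1 ≤ d`, `1 ≤ k`, `dk ≤ J′`, `dk ≤ J₂`, `Z^K_{Λ_{dk}} ≠ 0`, any rate `j`):
the statement of `klWtPinnedSumAt_klTowerIncr_le` with the slice `(Λ_{J₂}, Λ_{dk}]` — same right side (it only reads the input `𝒱_{dk}` at `F̃_{dk−1}`).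
[cite: BenfattoGiulianiMastropietro2006, §2.8 (2.83), §3 (3.2)-(3.8)] -/
theorem klWtPinnedSumAt_partialIncr_le {β : ℝ} (hβ : 0 < β) (U μ : ℝ) (K : TrigPolyC4v) {d k J' J₂ : ℕ} (j : ℕ) (hd : 1 ≤ d) (hk : 1 ≤ k)
    (hJ' : d * k ≤ J') (hJ₂ : d * k ≤ J₂)
    (hZ : hubbardEffPartitionFnCT L M β U μ 0 K (klScale klE0 (d * k)) ≠ 0)
    {κ : ℝ} (hκ : 0 < κ)
    (hGB : IsGramBoundedR ((sectorSubMatrix L M β (bgmFatMultiplier L M klE0 β (nambuXiCT L μ K) (d * k - 1))).transpose *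
      hubbardCovSliceCT L M β μ 0 K (klScale klE0 J₂) (klScale klE0 (d * k)) *
        sectorSubMatrix L M β (bgmFatMultiplier L M klE0 β (nambuXiCT L μ K) (d * k - 1))) κ)
    (B : ℕ → ℝ) (hB0 : ∀ m', 0 ≤ B m')
    (hB : ∀ (m' : ℕ) (t : Fin (2 * m')) (w : SpaceTimeIdx L M × SectorLeg (sectorCount (d * k - 1))),
      ∑ Y ∈ univ.filter (fun Y : Fin (2 * m') → SpaceTimeIdx L M × SectorLeg (sectorCount (d * k - 1)) => Y t = w),
        klScaleWt L M β j ((univ.image Y).image (latticeLegPos (2 * (2 * M)))) *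
          ‖kernel ℂ (ExteriorAlgebra.map (Matrix.toLin' (sectorAnalysisMatrix L M β (klAnisoFamily L M β μ K klE0 (d * k - 1))))
            (klTowerInput L M β U μ K d k)) (2 * m') Y‖ ≤ B m')
    {α : ℝ} (hα : 0 < α)
    (hrow : ∀ X, ∑ Y, ‖((sectorSubMatrix L M β (bgmFatMultiplier L M klE0 β (nambuXiCT L μ K) (d * k - 1))).transpose *
        hubbardCovSliceCT L M β μ 0 K (klScale klE0 J₂) (klScale klE0 (d * k)) *
          sectorSubMatrix L M β (bgmFatMultiplier L M klE0 β (nambuXiCT L μ K) (d * k - 1))) X Y‖ *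
        klScaleWt L M β j {latticeLegPos (2 * (2 * M)) X, latticeLegPos (2 * (2 * M)) Y} ≤ α)
    (hcol : ∀ Y, ∑ X, ‖((sectorSubMatrix L M β (bgmFatMultiplier L M klE0 β (nambuXiCT L μ K) (d * k - 1))).transpose *
        hubbardCovSliceCT L M β μ 0 K (klScale klE0 J₂) (klScale klE0 (d * k)) *
          sectorSubMatrix L M β (bgmFatMultiplier L M klE0 β (nambuXiCT L μ K) (d * k - 1))) X Y‖ *
        klScaleWt L M β j {latticeLegPos (2 * (2 * M)) X, latticeLegPos (2 * (2 * M)) Y} ≤ α)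
    {ρ : ℝ} (hρ : 0 < ρ)
    (hθ : Real.exp 1 * α * normV (SpaceTimeIdx L M × SectorLeg (sectorCount (d * k - 1))) κ ρ
      (fun m' => imagTimeWeight β M ^ (2 * m') * B m') / κ ^ 2 < 1)
    {cr cc : ℝ} (hcc0 : 0 ≤ cc)
    (hrow' : ∀ X'', ∑ X', ‖(sectorAnalysisMatrix L M β (klAnisoFamily L M β μ K klE0 J') *
        sectorSubMatrix L M β (bgmFatMultiplier L M klE0 β (nambuXiCT L μ K) (d * k - 1))) X'' X'‖ *
        klScaleWt L M β j {latticeLegPos (2 * (2 * M)) X'', latticeLegPos (2 * (2 * M)) X'} ≤ cr)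
    (hcol' : ∀ X', ∑ X'', ‖(sectorAnalysisMatrix L M β (klAnisoFamily L M β μ K klE0 J') *
        sectorSubMatrix L M β (bgmFatMultiplier L M klE0 β (nambuXiCT L μ K) (d * k - 1))) X'' X'‖ *
        klScaleWt L M β j {latticeLegPos (2 * (2 * M)) X'', latticeLegPos (2 * (2 * M)) X'} ≤ cc)
    {N₀ : ℕ} (hN₀ : 2 ≤ N₀) (q : ℕ) (i : Fin (2 * (q + 1))) (w'' : SpaceTimeIdx L M × SectorLeg (sectorCount J')) :
    klWtPinnedSumAt L M β μ K J' j (2 * (q + 1)) (klEffectiveAction L M β U μ K klE0 J₂ - klTowerInput L M β U μ K d k) i w'' ≤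
      imagTimeWeight β M ^ (2 * q + 1) *
        (cr * cc ^ (2 * q + 1) *
          (∑ n ∈ Ico 2 N₀, (ρ⁻¹ ^ (2 * q + 1 + 1) * κ⁻¹ ^ (2 * (n - 1)) * (α ^ (n - 1) * Real.exp n)) *
              ∑ δ ∈ (Fintype.piFinset fun _ : Fin n => range (Fintype.card (SpaceTimeIdx L M × SectorLeg (sectorCount (d * k - 1))) / 2 + 1)) with
                  2 * q + 1 + 1 + 2 * (n - 1) ≤ ∑ a, 2 * δ a,
                ∏ a, (Real.exp 2 * (κ + ρ)) ^ (2 * δ a) * (imagTimeWeight β M ^ (2 * δ a) * B (δ a)) +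
            ρ⁻¹ ^ (2 * q + 1 + 1) *
              (Real.exp 1 * normV (SpaceTimeIdx L M × SectorLeg (sectorCount (d * k - 1))) κ ρ (fun m' => imagTimeWeight β M ^ (2 * m') * B m')) *
              (Real.exp 1 * α * normV (SpaceTimeIdx L M × SectorLeg (sectorCount (d * k - 1))) κ ρ
                  (fun m' => imagTimeWeight β M ^ (2 * m') * B m') / κ ^ 2) ^ (N₀ - 1) /
              (1 - Real.exp 1 * α * normV (SpaceTimeIdx L M × SectorLeg (sectorCount (d * k - 1))) κ ρ
                  (fun m' => imagTimeWeight β M ^ (2 * m') * B m') / κ ^ 2)) +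
        cr * cc ^ (2 * q + 1) *
          ∑ m' ∈ range (Fintype.card (SpaceTimeIdx L M × SectorLeg (sectorCount (d * k - 1))) / 2 + 1),
            (if q + 1 < m' then ((2 * m').choose (2 * (q + 1)) : ℝ) * κ ^ (2 * m' - 2 * (q + 1)) *
              (imagTimeWeight β M ^ (2 * m') * B m') else 0)) := by
  have hβ' : β ≠ 0 := hβ.ne'
  have hJ₁ : 1 ≤ d * k := le_trans hd (Nat.le_mul_of_pos_right d hk)
  have hJ : d * k ≤ J₂ := hJ₂
  have hwt := isTreeWeight_klScaleWt L M hβ.le j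
  have hG : klTowerInput L M β U μ K d k ∈ evenPart ℂ (HubbardFieldIdx L M) := klEffectiveAction_mem_evenPart hβ' U μ K klE0 (d * k)
  have hG0 : constPart ℂ (klTowerInput L M β U μ K d k) = 0 := constPart_klEffectiveAction_eq_zero β U μ K klE0 (d * k) hZ
  have hε : 0 ≤ imagTimeWeight β M := imagTimeWeight_nonneg hβ.le M
  -- split the increment and the pinned sum
  have h2 := blockStep_ordersGe2_wt_le (L := L) (M := M) hwt hβ μ K hJ₁ hJ hJ' (latticeLegPos (2 * (2 * M))) (latticeLegPos (2 * (2 * M)))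
    (klTowerInput L M β U μ K d k) hG hG0 hκ hGB B hB0 hB hα hrow hcol hρ hθ hcc0 hrow' hcol' hN₀ (2 * q + 1) i w''
  have h1 := blockStep_firstOrder_wt_le (L := L) (M := M) hwt hβ μ K hJ₁ hJ hJ' (latticeLegPos (2 * (2 * M))) (latticeLegPos (2 * (2 * M)))
    (klTowerInput L M β U μ K d k) hG hκ.le hGB B hB0 hB hcc0 hrow' hcol' q i w''
  rw [partialIncr_eq_ordersGe2_add_firstOrder β U μ K d k J₂ hZ]
  refine (klWtPinnedSumAt_add_le hβ.le μ K J' j _ _ _ i w'').trans ?_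
  rw [mul_add (imagTimeWeight β M ^ (2 * q + 1))]
  exact add_le_add
    ((klWtPinnedSumAt_succ β μ K J' j (2 * q + 1) _ i w'').trans_le (mul_le_mul_of_nonneg_left h2 (pow_nonneg hε _)))
    ((klWtPinnedSumAt_succ β μ K J' j (2 * q + 1) _ i w'').trans_le (mul_le_mul_of_nonneg_left h1 (pow_nonneg hε _)))

/-- §2 **THE WEIGHTED BLOCK-STEP KIT ON THE PARTIAL INCREMENT** — §1 with its door guard served by the KIT guard on `N m′ := ε^{2m′}·B m′`
(`towerNumerics_doorBrackets_le_kit`); twin of `klWtPinnedSumAt_klTowerIncr_le_kit`. [cite: BenfattoGiulianiMastropietro2006, §3 (3.2)-(3.8)] -/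
theorem klWtPinnedSumAt_partialIncr_le_kit {β : ℝ} (hβ : 0 < β) (U μ : ℝ) (K : TrigPolyC4v) {d k J' J₂ : ℕ} (j : ℕ) (hd : 1 ≤ d) (hk : 1 ≤ k)
    (hJ' : d * k ≤ J') (hJ₂ : d * k ≤ J₂)
    (hZ : hubbardEffPartitionFnCT L M β U μ 0 K (klScale klE0 (d * k)) ≠ 0)
    {κ : ℝ} (hκ : 0 < κ)
    (hGB : IsGramBoundedR ((sectorSubMatrix L M β (bgmFatMultiplier L M klE0 β (nambuXiCT L μ K) (d * k - 1))).transpose *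
      hubbardCovSliceCT L M β μ 0 K (klScale klE0 J₂) (klScale klE0 (d * k)) *
        sectorSubMatrix L M β (bgmFatMultiplier L M klE0 β (nambuXiCT L μ K) (d * k - 1))) κ)
    (B : ℕ → ℝ) (hB0 : ∀ m', 0 ≤ B m') (hB00 : B 0 = 0)
    (hB : ∀ (m' : ℕ) (t : Fin (2 * m')) (w : SpaceTimeIdx L M × SectorLeg (sectorCount (d * k - 1))),
      ∑ Y ∈ univ.filter (fun Y : Fin (2 * m') → SpaceTimeIdx L M × SectorLeg (sectorCount (d * k - 1)) => Y t = w),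
        klScaleWt L M β j ((univ.image Y).image (latticeLegPos (2 * (2 * M)))) *
          ‖kernel ℂ (ExteriorAlgebra.map (Matrix.toLin' (sectorAnalysisMatrix L M β (klAnisoFamily L M β μ K klE0 (d * k - 1))))
            (klTowerInput L M β U μ K d k)) (2 * m') Y‖ ≤ B m')
    {α : ℝ} (hα : 0 < α)
    (hrow : ∀ X, ∑ Y, ‖((sectorSubMatrix L M β (bgmFatMultiplier L M klE0 β (nambuXiCT L μ K) (d * k - 1))).transpose *
        hubbardCovSliceCT L M β μ 0 K (klScale klE0 J₂) (klScale klE0 (d * k)) *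
          sectorSubMatrix L M β (bgmFatMultiplier L M klE0 β (nambuXiCT L μ K) (d * k - 1))) X Y‖ *
        klScaleWt L M β j {latticeLegPos (2 * (2 * M)) X, latticeLegPos (2 * (2 * M)) Y} ≤ α)
    (hcol : ∀ Y, ∑ X, ‖((sectorSubMatrix L M β (bgmFatMultiplier L M klE0 β (nambuXiCT L μ K) (d * k - 1))).transpose *
        hubbardCovSliceCT L M β μ 0 K (klScale klE0 J₂) (klScale klE0 (d * k)) *
          sectorSubMatrix L M β (bgmFatMultiplier L M klE0 β (nambuXiCT L μ K) (d * k - 1))) X Y‖ *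
        klScaleWt L M β j {latticeLegPos (2 * (2 * M)) X, latticeLegPos (2 * (2 * M)) Y} ≤ α)
    {ρ : ℝ} (hρ : 0 < ρ) {D : ℕ} (hD : Fintype.card (SpaceTimeIdx L M × SectorLeg (sectorCount (d * k - 1))) / 2 ≤ D)
    (hguard : Real.exp 1 * α / κ ^ 2 *
      towerV D ((Real.exp 2 * (κ + ρ)) ^ 2) (fun m' => imagTimeWeight β M ^ (2 * m') * B m') < 1)
    {cr cc : ℝ} (hcr0 : 0 ≤ cr) (hcc0 : 0 ≤ cc)
    (hrow' : ∀ X'', ∑ X', ‖(sectorAnalysisMatrix L M β (klAnisoFamily L M β μ K klE0 J') *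
        sectorSubMatrix L M β (bgmFatMultiplier L M klE0 β (nambuXiCT L μ K) (d * k - 1))) X'' X'‖ *
        klScaleWt L M β j {latticeLegPos (2 * (2 * M)) X'', latticeLegPos (2 * (2 * M)) X'} ≤ cr)
    (hcol' : ∀ X', ∑ X'', ‖(sectorAnalysisMatrix L M β (klAnisoFamily L M β μ K klE0 J') *
        sectorSubMatrix L M β (bgmFatMultiplier L M klE0 β (nambuXiCT L μ K) (d * k - 1))) X'' X'‖ *
        klScaleWt L M β j {latticeLegPos (2 * (2 * M)) X'', latticeLegPos (2 * (2 * M)) X'} ≤ cc)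
    {N₀ : ℕ} (hN₀ : 2 ≤ N₀) (q : ℕ) (i : Fin (2 * (q + 1))) (w'' : SpaceTimeIdx L M × SectorLeg (sectorCount J')) :
    klWtPinnedSumAt L M β μ K J' j (2 * (q + 1)) (klEffectiveAction L M β U μ K klE0 J₂ - klTowerInput L M β U μ K d k) i w'' ≤
      imagTimeWeight β M ^ (2 * q + 1) *
        (cr * cc ^ (2 * q + 1) *
          (towerFO D (κ ^ 2) (fun m' => imagTimeWeight β M ^ (2 * m') * B m') (q + 1) +
            ∑ n ∈ Icc 2 (N₀ - 1), Real.exp 1 * (Real.exp 1 * α / κ ^ 2) ^ (n - 1) * (ρ⁻¹ ^ 2) ^ (q + 1) *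
              towerS D ((Real.exp 2 * (κ + ρ)) ^ 2) (fun m' => imagTimeWeight β M ^ (2 * m') * B m') n (q + 1) +
            (ρ⁻¹ ^ 2) ^ (q + 1) * Real.exp 1 * towerV D ((Real.exp 2 * (κ + ρ)) ^ 2) (fun m' => imagTimeWeight β M ^ (2 * m') * B m') *
              (Real.exp 1 * α / κ ^ 2 * towerV D ((Real.exp 2 * (κ + ρ)) ^ 2) (fun m' => imagTimeWeight β M ^ (2 * m') * B m')) ^ (N₀ - 1) /
              (1 - Real.exp 1 * α / κ ^ 2 * towerV D ((Real.exp 2 * (κ + ρ)) ^ 2) (fun m' => imagTimeWeight β M ^ (2 * m') * B m')))) := by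
  set N : ℕ → ℝ := fun m' => imagTimeWeight β M ^ (2 * m') * B m' with hN
  have hε : 0 ≤ imagTimeWeight β M := imagTimeWeight_nonneg hβ.le M
  have hN0 : ∀ m, 0 ≤ N m := fun m => mul_nonneg (pow_nonneg hε _) (hB0 m)
  have hN00 : N 0 = 0 := by simp [hN, hB00]
  -- the door guard from the kit guard
  have hnV := normV_le_towerV (Γ := SpaceTimeIdx L M × SectorLeg (sectorCount (d * k - 1))) hκ.le hρ.le hN0 hN00 hD
  have hθ : Real.exp 1 * α * normV (SpaceTimeIdx L M × SectorLeg (sectorCount (d * k - 1))) κ ρ N / κ ^ 2 < 1 := by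
    have heq : Real.exp 1 * α * normV (SpaceTimeIdx L M × SectorLeg (sectorCount (d * k - 1))) κ ρ N / κ ^ 2 =
        Real.exp 1 * α / κ ^ 2 * normV (SpaceTimeIdx L M × SectorLeg (sectorCount (d * k - 1))) κ ρ N := by ring
    rw [heq]
    exact lt_of_le_of_lt (mul_le_mul_of_nonneg_left hnV (by positivity)) hguard
  have hborn := klWtPinnedSumAt_partialIncr_le (L := L) (M := M) hβ U μ K j hd hk hJ' hJ₂ hZ hκ hGB B hB0 hB hα hrow hcol hρ hθ hcc0 hrow' hcol'
    hN₀ q i w''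
  refine hborn.trans (mul_le_mul_of_nonneg_left ?_ (pow_nonneg hε _))
  exact towerNumerics_doorBrackets_le_kit hκ hρ hα.le hcr0 hcc0 hN0 hN00 hD hN₀ q hguard

/-- §3 **THE PARTIAL-INCREMENT KIT WITH THE CARRIER `klTowerMeasWtAt … d k j` AS INPUT MAJORANT, ANY UNITS `(u, Kc)`** (pin by pin; twin of
`klTowerBornWtAt_le_kit` ∘ `klTowerBornWtAt_le_kit_units`; `μ m := klTowerMeasWtAt … (2m)/(Kc·u^m)`). [cite: BenfattoGiulianiMastropietro2006, §3 (3.2)-(3.8)] -/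
theorem klWtPinnedSumAt_partialIncr_le_kit_units {β : ℝ} (hβ : 0 < β) (U μ : ℝ) (K : TrigPolyC4v) {d k J' J₂ : ℕ} (j : ℕ) (hd : 1 ≤ d) (hk : 1 ≤ k)
    (hJ' : d * k ≤ J') (hJ₂ : d * k ≤ J₂)
    (hZ : hubbardEffPartitionFnCT L M β U μ 0 K (klScale klE0 (d * k)) ≠ 0)
    {κ : ℝ} (hκ : 0 < κ)
    (hGB : IsGramBoundedR ((sectorSubMatrix L M β (bgmFatMultiplier L M klE0 β (nambuXiCT L μ K) (d * k - 1))).transpose *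
      hubbardCovSliceCT L M β μ 0 K (klScale klE0 J₂) (klScale klE0 (d * k)) *
        sectorSubMatrix L M β (bgmFatMultiplier L M klE0 β (nambuXiCT L μ K) (d * k - 1))) κ)
    {α : ℝ} (hα : 0 < α)
    (hrow : ∀ X, ∑ Y, ‖((sectorSubMatrix L M β (bgmFatMultiplier L M klE0 β (nambuXiCT L μ K) (d * k - 1))).transpose *
        hubbardCovSliceCT L M β μ 0 K (klScale klE0 J₂) (klScale klE0 (d * k)) *
          sectorSubMatrix L M β (bgmFatMultiplier L M klE0 β (nambuXiCT L μ K) (d * k - 1))) X Y‖ *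
        klScaleWt L M β j {latticeLegPos (2 * (2 * M)) X, latticeLegPos (2 * (2 * M)) Y} ≤ α)
    (hcol : ∀ Y, ∑ X, ‖((sectorSubMatrix L M β (bgmFatMultiplier L M klE0 β (nambuXiCT L μ K) (d * k - 1))).transpose *
        hubbardCovSliceCT L M β μ 0 K (klScale klE0 J₂) (klScale klE0 (d * k)) *
          sectorSubMatrix L M β (bgmFatMultiplier L M klE0 β (nambuXiCT L μ K) (d * k - 1))) X Y‖ *
        klScaleWt L M β j {latticeLegPos (2 * (2 * M)) X, latticeLegPos (2 * (2 * M)) Y} ≤ α)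
    {ρ : ℝ} (hρ : 0 < ρ) {D : ℕ} (hD : Fintype.card (SpaceTimeIdx L M × SectorLeg (sectorCount (d * k - 1))) / 2 ≤ D)
    (hguard : Real.exp 1 * α / κ ^ 2 *
      towerV D ((Real.exp 2 * (κ + ρ)) ^ 2) (fun m' => imagTimeWeight β M * klTowerMeasWtAt L M β U μ K d k j (2 * m')) < 1)
    {cr cc : ℝ} (hcr0 : 0 ≤ cr) (hcc0 : 0 ≤ cc)
    (hrow' : ∀ X'', ∑ X', ‖(sectorAnalysisMatrix L M β (klAnisoFamily L M β μ K klE0 J') *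
        sectorSubMatrix L M β (bgmFatMultiplier L M klE0 β (nambuXiCT L μ K) (d * k - 1))) X'' X'‖ *
        klScaleWt L M β j {latticeLegPos (2 * (2 * M)) X'', latticeLegPos (2 * (2 * M)) X'} ≤ cr)
    (hcol' : ∀ X', ∑ X'', ‖(sectorAnalysisMatrix L M β (klAnisoFamily L M β μ K klE0 J') *
        sectorSubMatrix L M β (bgmFatMultiplier L M klE0 β (nambuXiCT L μ K) (d * k - 1))) X'' X'‖ *
        klScaleWt L M β j {latticeLegPos (2 * (2 * M)) X'', latticeLegPos (2 * (2 * M)) X'} ≤ cc)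
    {N₀ : ℕ} (hN₀ : 2 ≤ N₀) (q : ℕ) (i : Fin (2 * (q + 1))) (w'' : SpaceTimeIdx L M × SectorLeg (sectorCount J')) {u Kc : ℝ} (hu : 0 < u)
    (hKc : 0 < Kc) :
    klWtPinnedSumAt L M β μ K J' j (2 * (q + 1)) (klEffectiveAction L M β U μ K klE0 J₂ - klTowerInput L M β U μ K d k) i w'' ≤
      (imagTimeWeight β M * cr) * (imagTimeWeight β M * cc) ^ (2 * q + 1) * (u ^ (q + 1) * Kc) *
        (towerFO D (κ ^ 2 * u) (fun m => klTowerMeasWtAt L M β U μ K d k j (2 * m) / (Kc * u ^ m)) (q + 1) +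
          ∑ n ∈ Icc 2 (N₀ - 1), Real.exp 1 * (Real.exp 1 * α / κ ^ 2 * (imagTimeWeight β M * Kc)) ^ (n - 1) * (ρ⁻¹ ^ 2 / u) ^ (q + 1) *
            towerS D ((Real.exp 2 * (κ + ρ)) ^ 2 * u) (fun m => klTowerMeasWtAt L M β U μ K d k j (2 * m) / (Kc * u ^ m)) n (q + 1) +
          (ρ⁻¹ ^ 2 / u) ^ (q + 1) * Real.exp 1 *
            towerV D ((Real.exp 2 * (κ + ρ)) ^ 2 * u) (fun m => klTowerMeasWtAt L M β U μ K d k j (2 * m) / (Kc * u ^ m)) *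
            (Real.exp 1 * α / κ ^ 2 * (imagTimeWeight β M * Kc) *
              towerV D ((Real.exp 2 * (κ + ρ)) ^ 2 * u) (fun m => klTowerMeasWtAt L M β U μ K d k j (2 * m) / (Kc * u ^ m))) ^ (N₀ - 1) /
            (1 - Real.exp 1 * α / κ ^ 2 * (imagTimeWeight β M * Kc) *
              towerV D ((Real.exp 2 * (κ + ρ)) ^ 2 * u) (fun m => klTowerMeasWtAt L M β U μ K d k j (2 * m) / (Kc * u ^ m)))) := by
  have hε := imagTimeWeight_pos_of_pos (M := M) hβ
  set B : ℕ → ℝ := fun m' => klTowerMeasWtAt L M β U μ K d k j (2 * m') / imagTimeWeight β M ^ (2 * m' - 1) with hBdef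
  have hB0 : ∀ m', 0 ≤ B m' := fun m' => div_nonneg (klTowerMeasWtAt_nonneg hβ.le U μ K d k j _) (pow_nonneg hε.le _)
  have hB00 : B 0 = 0 := by simp [hBdef, klTowerMeasWtAt_zero]
  have hB : ∀ (m' : ℕ) (t : Fin (2 * m')) (w : SpaceTimeIdx L M × SectorLeg (sectorCount (d * k - 1))),
      ∑ Y ∈ univ.filter (fun Y : Fin (2 * m') → SpaceTimeIdx L M × SectorLeg (sectorCount (d * k - 1)) => Y t = w),
        klScaleWt L M β j ((univ.image Y).image (latticeLegPos (2 * (2 * M)))) *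
          ‖kernel ℂ (ExteriorAlgebra.map (Matrix.toLin' (sectorAnalysisMatrix L M β (klAnisoFamily L M β μ K klE0 (d * k - 1))))
            (klTowerInput L M β U μ K d k)) (2 * m') Y‖ ≤ B m' :=
    fun m' t w => towerInputMajorant_of_klTowerMeasWtAt hβ U μ K d k j m' t w
  have hNeq := towerInputSizes_eq (L := L) (M := M) hβ U μ K d k j
  have hguard' : Real.exp 1 * α / κ ^ 2 *
      towerV D ((Real.exp 2 * (κ + ρ)) ^ 2) (fun m' => imagTimeWeight β M ^ (2 * m') * B m') < 1 := by
    rw [hBdef]; rw [hNeq]; exact hguard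
  have h := klWtPinnedSumAt_partialIncr_le_kit (L := L) (M := M) hβ U μ K j hd hk hJ' hJ₂ hZ hκ hGB B hB0 hB00 hB hα hrow hcol hρ hD hguard'
    hcr0 hcc0 hrow' hcol' hN₀ q i w''
  rw [hBdef] at h; rw [hNeq] at h
  have hN := towerInputSizes_units (ε := imagTimeWeight β M) hu.ne' hKc.ne' (fun m => klTowerMeasWtAt L M β U μ K d k j m)
  rw [hN] at h
  rw [kitStep_abs_eq_units_mul (mul_ne_zero hε.ne' hKc.ne') hu.ne'] at h
  refine h.trans (le_of_eq ?_)
  ring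

/-- §4 **THE WEIGHTED PARTIAL-INCREMENT STEP IN FLOOR UNITS AT k-FREE BOUNDS OF THE DATA** (twin of W2 `klTowerBornWtAt_succ_le_kitStep_of_bounds`, slice
`(Λ_{J₂}, Λ_{dk}]`, output family `F_{J′}`; parameters in the module docstring). [cite: BenfattoGiulianiMastropietro2006, §2.8 (2.76)-(2.84), §3 (3.2)-(3.8)] -/
theorem klWtPinnedSumAt_partialIncr_le_kitStep_of_bounds {β : ℝ} (hβ : 0 < β) (U μ : ℝ) (K : TrigPolyC4v) {d k J' J₂ : ℕ} (j : ℕ) (hd : 1 ≤ d)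
    (hk : 1 ≤ k) (hJ' : d * k ≤ J') (hJ₂ : d * k ≤ J₂)
    (hZ : hubbardEffPartitionFnCT L M β U μ 0 K (klScale klE0 (d * k)) ≠ 0)
    {κ κb : ℝ} (hκ : 0 < κ) (hκb : 0 < κb) (hκκb : κ ^ 2 * (8 : ℝ) ^ (d * k) ≤ κb ^ 2)
    (hGB : IsGramBoundedR ((sectorSubMatrix L M β (bgmFatMultiplier L M klE0 β (nambuXiCT L μ K) (d * k - 1))).transpose *
      hubbardCovSliceCT L M β μ 0 K (klScale klE0 J₂) (klScale klE0 (d * k)) *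
        sectorSubMatrix L M β (bgmFatMultiplier L M klE0 β (nambuXiCT L μ K) (d * k - 1))) κ)
    {α αb : ℝ} (hαb : 0 < αb) (hααb : α ≤ αb * (4 : ℝ) ^ (d * k))
    (hrow : ∀ X, ∑ Y, ‖((sectorSubMatrix L M β (bgmFatMultiplier L M klE0 β (nambuXiCT L μ K) (d * k - 1))).transpose *
        hubbardCovSliceCT L M β μ 0 K (klScale klE0 J₂) (klScale klE0 (d * k)) *
          sectorSubMatrix L M β (bgmFatMultiplier L M klE0 β (nambuXiCT L μ K) (d * k - 1))) X Y‖ *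
        klScaleWt L M β j {latticeLegPos (2 * (2 * M)) X, latticeLegPos (2 * (2 * M)) Y} ≤ α)
    (hcol : ∀ Y, ∑ X, ‖((sectorSubMatrix L M β (bgmFatMultiplier L M klE0 β (nambuXiCT L μ K) (d * k - 1))).transpose *
        hubbardCovSliceCT L M β μ 0 K (klScale klE0 J₂) (klScale klE0 (d * k)) *
          sectorSubMatrix L M β (bgmFatMultiplier L M klE0 β (nambuXiCT L μ K) (d * k - 1))) X Y‖ *
        klScaleWt L M β j {latticeLegPos (2 * (2 * M)) X, latticeLegPos (2 * (2 * M)) Y} ≤ α)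
    {crb ccb : ℝ} (hcrb : 0 < crb) (hccb : 0 < ccb)
    (hrow' : ∀ X'', ∑ X', ‖(sectorAnalysisMatrix L M β (klAnisoFamily L M β μ K klE0 J') *
        sectorSubMatrix L M β (bgmFatMultiplier L M klE0 β (nambuXiCT L μ K) (d * k - 1))) X'' X'‖ *
        klScaleWt L M β j {latticeLegPos (2 * (2 * M)) X'', latticeLegPos (2 * (2 * M)) X'} ≤ crb)
    (hcol' : ∀ X', ∑ X'', ‖(sectorAnalysisMatrix L M β (klAnisoFamily L M β μ K klE0 J') *
        sectorSubMatrix L M β (bgmFatMultiplier L M klE0 β (nambuXiCT L μ K) (d * k - 1))) X'' X'‖ *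
        klScaleWt L M β j {latticeLegPos (2 * (2 * M)) X'', latticeLegPos (2 * (2 * M)) X'} ≤ ccb)
    {D : ℕ} (hD : Fintype.card (SpaceTimeIdx L M × SectorLeg (sectorCount (d * k - 1))) / 2 ≤ D)
    {N : ℕ} (hN : 1 ≤ N)
    (hguard : exp 1 * αb * ccb / (κb ^ 2 * crb) *
      towerV D (4 * exp 4 * κb ^ 2 / ccb ^ 2)
        (fun m => 32 * crb / ccb * (imagTimeWeight β M ^ 2 * ccb ^ 2 / 8) ^ m *
          (klTowerMeasWtAt L M β U μ K d k j (2 * m) / klLevUnitF β M 0 m (d * k - 1))) < 1)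
    (q : ℕ) (i : Fin (2 * (q + 1))) (w'' : SpaceTimeIdx L M × SectorLeg (sectorCount J')) :
    klWtPinnedSumAt L M β μ K J' j (2 * (q + 1)) (klEffectiveAction L M β U μ K klE0 J₂ - klTowerInput L M β U μ K d k) i w'' /
        klLevUnitF β M 0 (q + 1) (d * k) ≤
      towerFO D (κb ^ 2 / ccb ^ 2)
          (fun m => 32 * crb / ccb * (imagTimeWeight β M ^ 2 * ccb ^ 2 / 8) ^ m *
            (klTowerMeasWtAt L M β U μ K d k j (2 * m) / klLevUnitF β M 0 m (d * k - 1))) (q + 1) +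
        ∑ n ∈ Icc 2 N, exp 1 * (exp 1 * αb * ccb / (κb ^ 2 * crb)) ^ (n - 1) * (ccb ^ 2 / κb ^ 2) ^ (q + 1) *
          towerS D (4 * exp 4 * κb ^ 2 / ccb ^ 2)
            (fun m => 32 * crb / ccb * (imagTimeWeight β M ^ 2 * ccb ^ 2 / 8) ^ m *
              (klTowerMeasWtAt L M β U μ K d k j (2 * m) / klLevUnitF β M 0 m (d * k - 1))) n (q + 1) +
        (ccb ^ 2 / κb ^ 2) ^ (q + 1) * exp 1 *
          towerV D (4 * exp 4 * κb ^ 2 / ccb ^ 2)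
            (fun m => 32 * crb / ccb * (imagTimeWeight β M ^ 2 * ccb ^ 2 / 8) ^ m *
              (klTowerMeasWtAt L M β U μ K d k j (2 * m) / klLevUnitF β M 0 m (d * k - 1))) *
          (exp 1 * αb * ccb / (κb ^ 2 * crb) *
            towerV D (4 * exp 4 * κb ^ 2 / ccb ^ 2)
              (fun m => 32 * crb / ccb * (imagTimeWeight β M ^ 2 * ccb ^ 2 / 8) ^ m *
                (klTowerMeasWtAt L M β U μ K d k j (2 * m) / klLevUnitF β M 0 m (d * k - 1)))) ^ N /
          (1 - exp 1 * αb * ccb / (κb ^ 2 * crb) *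
            towerV D (4 * exp 4 * κb ^ 2 / ccb ^ 2)
              (fun m => 32 * crb / ccb * (imagTimeWeight β M ^ 2 * ccb ^ 2 / 8) ^ m *
                (klTowerMeasWtAt L M β U μ K d k j (2 * m) / klLevUnitF β M 0 m (d * k - 1)))) := by
  have hx : 0 < imagTimeWeight β M := imagTimeWeight_pos_of_pos (M := M) hβ
  have hJ₁ : 1 ≤ d * k := le_trans hk (Nat.le_mul_of_pos_left k (by omega))
  have h8 : (0 : ℝ) < (8 : ℝ) ^ (d * k) := by positivity
  have he1 : 0 < exp 1 := exp_pos 1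
  have he4' : exp 4 = exp 2 ^ 2 := by rw [← Real.exp_nat_mul]; norm_num
  -- the Gram constant at the bound: `κ′ ≥ κ`, `κ′²·8^{dk} = κ̄²`
  obtain ⟨κ', hκ'0, hκκ', hκ'sq⟩ := exists_sqrt_scaled hκ hκb h8 hκκb
  have hGB' := TorusFourierL2.isGramBoundedR_of_le hGB hκ.le hκκ'
  -- the decay constant at the bound
  have hα'0 : 0 < αb * (4 : ℝ) ^ (d * k) := by positivity
  have hrow2 : ∀ X, ∑ Y, ‖((sectorSubMatrix L M β (bgmFatMultiplier L M klE0 β (nambuXiCT L μ K) (d * k - 1))).transpose *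
      hubbardCovSliceCT L M β μ 0 K (klScale klE0 J₂) (klScale klE0 (d * k)) *
        sectorSubMatrix L M β (bgmFatMultiplier L M klE0 β (nambuXiCT L μ K) (d * k - 1))) X Y‖ *
        klScaleWt L M β j {latticeLegPos (2 * (2 * M)) X, latticeLegPos (2 * (2 * M)) Y} ≤ αb * (4 : ℝ) ^ (d * k) :=
    fun X => (hrow X).trans hααb
  have hcol2 : ∀ Y, ∑ X, ‖((sectorSubMatrix L M β (bgmFatMultiplier L M klE0 β (nambuXiCT L μ K) (d * k - 1))).transpose *
      hubbardCovSliceCT L M β μ 0 K (klScale klE0 J₂) (klScale klE0 (d * k)) *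
        sectorSubMatrix L M β (bgmFatMultiplier L M klE0 β (nambuXiCT L μ K) (d * k - 1))) X Y‖ *
        klScaleWt L M β j {latticeLegPos (2 * (2 * M)) X, latticeLegPos (2 * (2 * M)) Y} ≤ αb * (4 : ℝ) ^ (d * k) :=
    fun Y => (hcol Y).trans hααb
  -- abbreviations: the input boundary's units, the unit-free measured array, the parameters
  set ε : ℝ := imagTimeWeight β M with hε
  set Kc : ℝ := ε * ((((2 : ℝ) ^ (5 * (d * k - 1))))⁻¹ * (ε ^ 2)⁻¹) with hKc
  set u : ℝ := (8 : ℝ) ^ (d * k - 1) * ε ^ 2 with hu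
  set μ₁ : ℕ → ℝ := fun m => klTowerMeasWtAt L M β U μ K d k j (2 * m) / klLevUnitF β M 0 m (d * k - 1) with hμ₁
  set W : ℝ := 32 * crb / ccb with hW
  set Z : ℝ := ε ^ 2 * ccb ^ 2 / 8 with hZ'
  set σb : ℝ := κb ^ 2 / ccb ^ 2 with hσb
  set τb : ℝ := 4 * exp 4 * κb ^ 2 / ccb ^ 2 with hτb
  set ψb : ℝ := ccb ^ 2 / κb ^ 2 with hψb
  set Φb : ℝ := exp 1 * αb * ccb / (κb ^ 2 * crb) with hΦb
  have hKc0 : 0 < Kc := by positivity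
  have hu0 : 0 < u := by positivity
  have hW0 : 0 < W := by positivity
  have hZ0 : 0 < Z := by positivity
  have hμ₁0 : ∀ m, 0 ≤ μ₁ m := fun m =>
    div_nonneg (klTowerMeasWtAt_nonneg hβ.le U μ K d k j (2 * m)) (klLevUnitF_pos hβ 0 m (d * k - 1)).le
  -- `8^{dk} = 8^{dk−1}·8`, `4^{dk} = 4^{dk−1}·4`, `2^{5(dk−1)} = 4^{dk−1}·8^{dk−1}`
  have h8succ : (8 : ℝ) ^ (d * k) = (8 : ℝ) ^ (d * k - 1) * 8 := by rw [← pow_succ, Nat.sub_add_cancel hJ₁]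
  have h4succ : (4 : ℝ) ^ (d * k) = (4 : ℝ) ^ (d * k - 1) * 4 := by rw [← pow_succ, Nat.sub_add_cancel hJ₁]
  have h32 : (2 : ℝ) ^ (5 * (d * k - 1)) = (4 : ℝ) ^ (d * k - 1) * (8 : ℝ) ^ (d * k - 1) := by
    rw [← mul_pow, show (4 : ℝ) * 8 = 2 ^ 5 by norm_num, ← pow_mul]
  have h8p : (0 : ℝ) < (8 : ℝ) ^ (d * k - 1) := by positivity
  have h4p : (0 : ℝ) < (4 : ℝ) ^ (d * k - 1) := by positivity
  -- the carrier quotient in product units is `μ₁`; the absolute input sizes are `(ε·K_c)·(u^m·μ₁ m)`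
  have hμeq : (fun m : ℕ => klTowerMeasWtAt L M β U μ K d k j (2 * m) / (Kc * u ^ m)) = μ₁ := by
    rw [hμ₁, hKc, hu, hε]; exact towerMeasWtAt_div_units_eq hβ U μ K d k j
  have habs : (fun m : ℕ => imagTimeWeight β M * klTowerMeasWtAt L M β U μ K d k j (2 * m)) = fun m : ℕ => (ε * Kc) * (u ^ m * μ₁ m) := by
    rw [← hμeq]; exact towerInputSizes_units (ε := ε) hu0.ne' hKc0.ne' (fun m => klTowerMeasWtAt L M β U μ K d k j m)
  -- the scaled array in product form
  have hμbar : (fun m : ℕ => 32 * crb / ccb * (imagTimeWeight β M ^ 2 * ccb ^ 2 / 8) ^ m *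
      (klTowerMeasWtAt L M β U μ K d k j (2 * m) / klLevUnitF β M 0 m (d * k - 1))) = fun m : ℕ => W * (Z ^ m * μ₁ m) := by
    funext m; simp only [hW, hZ', hμ₁, hε]; ring
  -- the four parameter identities and the output constant
  have hσeq : σb * Z = κ' ^ 2 * u := by
    simp only [hσb, hZ', hu]; rw [← hκ'sq, h8succ]; field_simp
  have hτeq : τb * Z = (exp 2 * (κ' + κ')) ^ 2 * u := by
    simp only [hτb, hZ', hu]; rw [← hκ'sq, h8succ, he4']; field_simp; ring
  have hψeq : ψb / Z = κ'⁻¹ ^ 2 / u := by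
    simp only [hψb, hZ', hu]; rw [← hκ'sq, h8succ, inv_pow]; field_simp
  have hΦeq : Φb * W = exp 1 * (αb * (4 : ℝ) ^ (d * k)) / κ' ^ 2 * (ε * Kc) := by
    simp only [hΦb, hW, hKc]
    rw [← hκ'sq, h8succ, h4succ, h32]
    field_simp
    ring
  -- the guard of g13's kit form, from the final guard
  have hguardkit : exp 1 * (αb * (4 : ℝ) ^ (d * k)) / κ' ^ 2 *
      towerV D ((exp 2 * (κ' + κ')) ^ 2) (fun m' => imagTimeWeight β M * klTowerMeasWtAt L M β U μ K d k j (2 * m')) < 1 := by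
    have key : exp 1 * (αb * (4 : ℝ) ^ (d * k)) / κ' ^ 2 *
        towerV D ((exp 2 * (κ' + κ')) ^ 2) (fun m' => imagTimeWeight β M * klTowerMeasWtAt L M β U μ K d k j (2 * m')) =
        Φb * towerV D τb (fun m => 32 * crb / ccb * (imagTimeWeight β M ^ 2 * ccb ^ 2 / 8) ^ m *
          (klTowerMeasWtAt L M β U μ K d k j (2 * m) / klLevUnitF β M 0 m (d * k - 1))) := by
      rw [habs, hμbar, towerV_units, towerV_units, hτeq]
      calc exp 1 * (αb * (4 : ℝ) ^ (d * k)) / κ' ^ 2 * ((ε * Kc) * towerV D ((exp 2 * (κ' + κ')) ^ 2 * u) μ₁)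
          = (exp 1 * (αb * (4 : ℝ) ^ (d * k)) / κ' ^ 2 * (ε * Kc)) * towerV D ((exp 2 * (κ' + κ')) ^ 2 * u) μ₁ := by ring
        _ = (Φb * W) * towerV D ((exp 2 * (κ' + κ')) ^ 2 * u) μ₁ := by rw [hΦeq]
        _ = Φb * (W * towerV D ((exp 2 * (κ' + κ')) ^ 2 * u) μ₁) := by ring
    rw [key]; exact hguard
  -- (1) the pin-level kit form (§3) at the input boundary's units, truncation `N + 1`, radius `ρ := κ′`
  have hN₁ : 2 ≤ N + 1 := by omega
  have h1 := klWtPinnedSumAt_partialIncr_le_kit_units (L := L) (M := M) hβ U μ K j hd hk hJ' hJ₂ hZ hκ'0 hGB' hα'0 hrow2 hcol2 hκ'0 hD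
    hguardkit hcrb.le hccb.le hrow' hcol' hN₁ q i w'' hu0 hKc0
  rw [hμeq, Nat.add_sub_cancel] at h1
  -- (2) the final kit bracket in the input units: `kit(W̄·Z̄^m·μ₁; σ̄, τ̄, Φ̄, ψ̄) = (Z̄^{q+1}·W̄)·kit(μ₁; κ′²u, τ′u, Φ̂, ψ̂)`
  have hkit := kitStep_abs_eq_units_mul (K := W) (u := Z) hW0.ne' hZ0.ne' D σb τb Φb ψb μ₁ N (q + 1)
  rw [hσeq, hτeq, hΦeq, hψeq] at hkit
  -- (3) divide by the output unit
  have hunit : klLevUnitF β M 0 (q + 1) (d * k) = (Kc * u ^ (q + 1)) * ((8 : ℝ) ^ (q + 1) / 32) := by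
    rw [hKc, hu, hε]; exact klLevUnitF_zero_track_succ_units (M := M) hβ hJ₁ (by omega)
  have hU0 : 0 < klLevUnitF β M 0 (q + 1) (d * k) := klLevUnitF_pos hβ 0 _ _
  have hout : (imagTimeWeight β M * crb) * (imagTimeWeight β M * ccb) ^ (2 * q + 1) * (u ^ (q + 1) * Kc) =
      (Z ^ (q + 1) * W) * ((Kc * u ^ (q + 1)) * ((8 : ℝ) ^ (q + 1) / 32)) := by
    simp only [hZ', hW, hε, div_pow, mul_pow, ← pow_mul]
    field_simp
    ring
  rw [hμbar, hkit, div_le_iff₀ hU0, hunit]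
  refine h1.trans (le_of_eq ?_)
  rw [hout]
  ring

end Summit.HubbardSuperconductivity.HubbardSuperconductivity.Theorems.EngineV8

end
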